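import Literature.AlgebraicGeometry.Frobenioids.EquivalenceIstrSquare
import Literature.AlgebraicGeometry.Frobenioids.PreFrobenioidDataOfFunctor
import HarnessLib

/-!
# Frobenioids I, Theorem 3.4 (i) — the rigidity clause of the isotropification square: `C → C^istr`
# is rigid for `D` slim and `C` of Frobenius-normalized type

Mochizuki, *The geometry of Frobenioids I: the general theory*, Kyushu J. Math. **62** (2008)
293–400, Thm. 3.4 (i), kurims text p. 62 ("Finally, if `D₁, D₂` are slim, and `C₁, C₂` are of
Frobenius-normalized type, then each of the composite functors of this diagram is rigid", the diagram
being the `C → C^istr` square) and its proof p. 63 ll. 28–35: "By Proposition 1.13, (ii), it suffices to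
show, for each `A ∈ Ob(C^istr)` that the automorphism `α ∈ O^×(A)` induced by an automorphism
`∈ Aut(C₁ → C₁^istr)` is trivial. But, by Definition 1.3, (i), (a), (b); (iii), (c), it suffices to show this
when `A` is Frobenius-trivial, in which case the triviality of `α` follows from the functoriality of `α`
with respect to base-identity endomorphisms of `A` of arbitrary of Frobenius degree [which implies, since
`C₁, C₂` are of Frobenius-normalized type, that `α^d = α`, for all `d ∈ ℕ_{≥1}`, hence that `α` is trivial]"
[cite: MochizukiFrdI2008, Thm. 3.4 (i) p.62].

PROOF-ONLY file (seat abc-iut-w4-d090; no new notions) over THE isotropification functor of seat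
abc-iut-L1-t1 (`PreFrobenioid.isotropification hF : C ⥤ C^istr`, `Isotropification.lean`, built from
the chosen isotropic hulls `hullHom hF A : A → A^istr` with `hullHom A ≫ hullMor f = f ≫ hullHom B`);
the twin of `PerfectionRigidity.lean` (Thm. 3.4 (iii)) and `BirationalizationRigidity.lean` (Cor. 4.10):

* `Isotropification.base_app_eq_id` — for `D` slim the components `α_A : A^istr ≅ A^istr` of an
  automorphism `α` of `C → C^istr` are base-identity: conjugating `Base(α_A)` by the base-isomorphisms
  `Base(A → A^istr)` gives an automorphism of `C → D`, trivial by Prop. 1.13 (i);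
* (v2) the triviality of `α_A` at Frobenius-trivial `A` and **the rigidity of `C → C^istr` itself** are
  seat abc-iut-L1-d088's `PreFrobenioid.app_eq_id_of_isFrobeniusTrivial_of_iso_isotropification` /
  `PreFrobenioid.isRigidFunctor_isotropification` (`EquivalenceIstrSquare.lean`, landed first; this file's
  v1 carried byte-different proofs of both under clashing / duplicate names, removed in v2 and CITED);
* `isRigidFunctor_comp_isotropification` (precomposition with an equivalence),
  `isRigidFunctor_isotropification_comp_of_iso` (both composites of the Thm. 3.4 (i) square for ANY
  `Ψ^istr` making it `1`-commute) and `IsRigidFunctor.comp_full_faithful` (post-composition with a fully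
  faithful functor, e.g. the comparison
  `C^istr ⥤ C^istr` between the two renderings of the isotropic objects).

No statement of the paper is restated or strengthened; HONEST FRAMING: [FrdI] is a refereed, undisputed
paper; nothing here bears on [IUTchIII] Cor. 3.12 beyond supplying kernel-checked inputs by name.
-/

-- Components of natural isomorphisms between `C^istr`-valued functors have implicit objects that only
-- unfold at default transparency (as in `BaseCategoryTheoreticityProofs.lean`).
set_option backward.isDefEq.respectTransparency false

namespace Literature.AlgebraicGeometry.Frobenioids

open CategoryTheory Opposite

universe w v v' u u' v₁ u₁ v₂ u₂ v₃ u₃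

/-! ### Rigidity and fully faithful post-composition (§0 p. 14) -/

section Rigid

variable {P : Type u₁} [Category.{v₁} P] {Q : Type u₂} [Category.{v₂} Q] {R : Type u₃} [Category.{v₃} R]

/-- Post-composing a rigid functor with a fully faithful functor yields a rigid functor: an
automorphism of `F ⋙ G` has components `G(F X) ≅ G(F X)`, which lift uniquely along `G` to an
automorphism of `F`. [cite: MochizukiFrdI2008, §0 p.14] -/
theorem IsRigidFunctor.comp_full_faithful {F : P ⥤ Q} (hF : IsRigidFunctor F) (G : Q ⥤ R) [G.Full]
    [G.Faithful] : IsRigidFunctor (F ⋙ G) := by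
  intro α
  let β : F ≅ F := NatIso.ofComponents (fun X => G.preimageIso (α.app X)) (by
    intro X Y f
    apply G.map_injective
    simp only [Functor.map_comp, Functor.preimageIso_hom, Functor.map_preimage, Iso.app_hom]
    exact α.hom.naturality f)
  have hβ : β = Iso.refl F := hF β
  ext X
  have h := congrArg (fun i : F ≅ F => G.map (i.hom.app X)) hβ
  have h2 : α.hom.app X = G.map (β.hom.app X) := by simp [β]
  rw [h2, h]
  exact G.map_id (F.obj X)

end Rigid

namespace PreFrobenioid

variable {D : Type u} [Category.{v} D] {Φ : Dᵒᵖ ⥤ CommMonCat.{w}}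
  {C : Type u'} [Category.{v'} C] {F : C ⥤ ElemFrobenioid Φ}

namespace Isotropification

/-- The components of an automorphism of `C → C^istr`, as arrows `A^istr → A^istr` of `C`, are natural
with respect to `f ↦ f^istr`. [cite: MochizukiFrdI2008, Prop. 1.9 (v) p.32] -/
theorem hom_app_naturality (hF : IsFrobenioid F) (α : isotropification hF ≅ isotropification hF)
    {A B : C} (f : A ⟶ B) :
    hullMor hF f ≫ (α.hom.app B).hom = (α.hom.app A).hom ≫ hullMor hF f := by
  have h := congrArg InducedCategory.Hom.hom (α.hom.naturality f)
  exact h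

/-- The components of an automorphism of `C → C^istr` are isomorphisms of `C`.
[cite: MochizukiFrdI2008, Prop. 1.9 (v) p.32] -/
theorem isIso_hom_app (hF : IsFrobenioid F) (α : isotropification hF ≅ isotropification hF) (A : C) :
    IsIso (α.hom.app A).hom :=
  ⟨⟨(α.inv.app A).hom, congrArg InducedCategory.Hom.hom (α.hom_inv_id_app A),
    congrArg InducedCategory.Hom.hom (α.inv_hom_id_app A)⟩⟩

/-- For `D` slim: the components of an automorphism `α` of the isotropification functor are
base-identity automorphisms — conjugating `Base(α_A)` by the base-isomorphism `Base(A → A^istr)`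
yields an automorphism of `C → D`, trivial by Prop. 1.13 (i). [cite: MochizukiFrdI2008, Thm. 3.4 (i) p.63] -/
theorem base_app_eq_id (hF : IsFrobenioid F) (hD : IsSlim D)
    (α : isotropification hF ≅ isotropification hF) (A : C) : Base F (α.hom.app A).hom = 𝟙 _ := by
  haveI hh : ∀ X : C, IsIso (Base F (hullHom hF X)) := fun X => (isIsotropicHull_hullHom hF X).2.1.2
  haveI ha : ∀ X : C, IsIso (Base F (α.hom.app X).hom) := fun X => by
    haveI := isIso_hom_app hF α X
    exact isBaseIso_of_isIso F _
  -- the natural family `Base(hull_X) ≫ Base(α_X) ≫ Base(hull_X)⁻¹`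
  have hnat : ∀ {X Y : C} (f : X ⟶ Y),
      Base F f ≫ Base F (hullHom hF Y) ≫ Base F (α.hom.app Y).hom ≫ inv (Base F (hullHom hF Y)) =
        (Base F (hullHom hF X) ≫ Base F (α.hom.app X).hom ≫ inv (Base F (hullHom hF X))) ≫ Base F f := by
    intro X Y f
    have h1 : Base F f ≫ Base F (hullHom hF Y) = Base F (hullHom hF X) ≫ Base F (hullMor hF f) := by
      rw [← base_comp, ← hullHom_hullMor, base_comp]
    have h2 : Base F (hullMor hF f) ≫ Base F (α.hom.app Y).hom =
        Base F (α.hom.app X).hom ≫ Base F (hullMor hF f) := by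
      have h := congrArg (Base F) (hom_app_naturality hF α f)
      rwa [base_comp, base_comp] at h
    rw [← Category.assoc (Base F f), h1, Category.assoc, ← Category.assoc (Base F (hullMor hF f)), h2,
      Category.assoc, base_hullMor]
    simp only [Category.assoc, IsIso.hom_inv_id, Category.comp_id]
  let β : baseFunctor F ≅ baseFunctor F :=
    NatIso.ofComponents (fun X => asIso (Base F (hullHom hF X)) ≪≫ asIso (Base F (α.hom.app X).hom) ≪≫
      (asIso (Base F (hullHom hF X))).symm) (fun {X Y} f => hnat f)
  have hβ : β = Iso.refl _ := isRigidFunctor_baseFunctor hF hD β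
  have hβA : Base F (hullHom hF A) ≫ Base F (α.hom.app A).hom ≫ inv (Base F (hullHom hF A)) = 𝟙 _ :=
    congrArg (fun i : baseFunctor F ≅ baseFunctor F => i.hom.app A) hβ
  have h2 : Base F (hullHom hF A) ≫ Base F (α.hom.app A).hom = Base F (hullHom hF A) := by
    have := congrArg (· ≫ Base F (hullHom hF A)) hβA
    simpa only [Category.assoc, IsIso.inv_hom_id, Category.comp_id, Category.id_comp] using this
  exact (cancel_epi (Base F (hullHom hF A))).mp (h2.trans (Category.comp_id _).symm)

end Isotropification

section Square

variable {C₁ : Type u₁} [Category.{v₁} C₁] {I₁ : Type u₂} [Category.{v₂} I₁]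

/-- **Thm. 3.4 (i), rigidity, first composite**: `T ⋙ (C → C^istr)` is rigid for every equivalence
`T : C₁ ⥲ C`, `D` slim, `C` of Frobenius-normalized type — the composite `C₁ ⥲ C₂ → C₂^istr` of the
isotropification square. [cite: MochizukiFrdI2008, Thm. 3.4 (i) p.62] -/
theorem isRigidFunctor_comp_isotropification (hF : IsFrobenioid F) (hD : IsSlim D)
    (hN : (PreFrobenioidData.ofFunctor Φ F).IsOfFrobeniusNormalizedType) (T : C₁ ⥤ C) [T.IsEquivalence] :
    IsRigidFunctor (T ⋙ isotropification hF) :=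
  IsRigidFunctor.comp_of_isEquivalence T (isRigidFunctor_isotropification hF hD hN)

/-- **Thm. 3.4 (i), "each of the composite functors of this diagram is rigid"**: for an equivalence
`Ψ : C₁ ⥲ C₂`, any functor `L : C₁ → I₁` (e.g. `C₁ → C₁^istr`) and ANY `Ψ^istr : I₁ → C₂^istr` with
`Ψ ⋙ (C₂ → C₂^istr) ≅ L ⋙ Ψ^istr`, both composites are rigid (rigidity is invariant under isomorphism of
functors). [cite: MochizukiFrdI2008, Thm. 3.4 (i) p.62] -/
theorem isRigidFunctor_isotropification_comp_of_iso (hF : IsFrobenioid F) (hD : IsSlim D)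
    (hN : (PreFrobenioidData.ofFunctor Φ F).IsOfFrobeniusNormalizedType) (Ψ : C₁ ≌ C) (L : C₁ ⥤ I₁)
    (Ψistr : I₁ ⥤ Istr F) (η : Ψ.functor ⋙ isotropification hF ≅ L ⋙ Ψistr) :
    IsRigidFunctor (Ψ.functor ⋙ isotropification hF) ∧ IsRigidFunctor (L ⋙ Ψistr) := by
  have h := isRigidFunctor_comp_isotropification hF hD hN Ψ.functor
  refine ⟨h, fun β => ?_⟩
  have hβ := h (η ≪≫ β ≪≫ η.symm)
  have h' : β = η.symm ≪≫ (η ≪≫ β ≪≫ η.symm) ≪≫ η := by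
    ext X
    simp
  rw [h', hβ]
  ext X
  simp

end Square

end PreFrobenioid

end Literature.AlgebraicGeometry.Frobenioids
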